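import Literature.Geometry.Symplectic.WedgeOneTwoApply
import Literature.Geometry.Symplectic.WedgeTwoTwoApply
import Literature.LinearAlgebra.Alternating.WedgeOne
import HarnessLib

/-!
# The pointwise identity of McLean's cut-off Stokes argument: `dχ ∧ θ' ∧ ω = χ'(r²) θ'(X) · ω ∧ ω`

Topic `Literature/Geometry/Symplectic`; pointwise linear algebra for the sign of the wrapping
number in the fact seat of `Literature.Geometry.Symplectic.mclean_divisorComplement_convex_four`
(M. McLean, GAFA 22 (2012), Lemma 5.17).  On the punctured tube the cut-off is `χ = φ ∘ r²`, so
`dχ = φ'(r²) d(r²) = -2 φ'(r²) ω(X, ·)` (the rotation `X` is generated by `-r²/2`,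
`ω(X, ·) = -½ d(r²)`), and the `3`-form is `θ' ∧ ω` with `θ'(X) = κ + r²/2`.  Evaluated on any
frame `(X, v₂, v₃, v₄)` through the rotation vector,

  `(dχ ∧ (θ' ∧ ω))(X, v₂, v₃, v₄) = φ'(r²) · θ'(X) · (ω ∧ ω)(X, v₂, v₃, v₄)`

(`wedgeOne_wedge_apply_frame`), a `ring` identity once the three wedge products are expanded
(`wedgeOne_apply` of `Literature/LinearAlgebra/Alternating/WedgeOne.lean` — the convention of
the tree's Leibniz rule `mextDeriv_fun_smul_apply` —, `wedge_apply_one_two`,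
`wedge_self_apply_two`).  Consequently, where `φ' ≥ 0`, `θ'(X) ≥ 0` the `4`-form
`dχ ∧ θ' ∧ ω` is a non-negative multiple of the symplectic volume on such frames.

Everything is proved; no definitions, no named facts (D-0026).

## References

* M. McLean, *The growth rate of symplectic homology and affine varieties*, Geom. Funct. Anal. 22
  (2012), Lemma 5.17 (proof). [Mclean2012]
-/

noncomputable section

open Literature.LinearAlgebra.Alternating

namespace Literature.Geometry.Symplectic

variable {E : Type*} [NormedAddCommGroup E] [NormedSpace ℝ E]

omit [NormedAddCommGroup E] [NormedSpace ℝ E] in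
/-- `Fin.removeNth` on `4`-tuples. [folklore] -/
private theorem removeNth_zero_four' (a b c d : E) :
    (0 : Fin 4).removeNth (![a, b, c, d] : Fin 4 → E) = ![b, c, d] := by
  funext i; fin_cases i <;> rfl

omit [NormedAddCommGroup E] [NormedSpace ℝ E] in
/-- `Fin.removeNth` on `4`-tuples. [folklore] -/
private theorem removeNth_one_four' (a b c d : E) :
    (1 : Fin 4).removeNth (![a, b, c, d] : Fin 4 → E) = ![a, c, d] := by
  funext i; fin_cases i <;> rfl

omit [NormedAddCommGroup E] [NormedSpace ℝ E] in
/-- `Fin.removeNth` on `4`-tuples. [folklore] -/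
private theorem removeNth_two_four' (a b c d : E) :
    (2 : Fin 4).removeNth (![a, b, c, d] : Fin 4 → E) = ![a, b, d] := by
  funext i; fin_cases i <;> rfl

omit [NormedAddCommGroup E] [NormedSpace ℝ E] in
/-- `Fin.removeNth` on `4`-tuples. [folklore] -/
private theorem removeNth_three_four' (a b c d : E) :
    (3 : Fin 4).removeNth (![a, b, c, d] : Fin 4 → E) = ![a, b, c] := by
  funext i; fin_cases i <;> rfl

/-- **McLean's pointwise identity on a frame through the rotation vector.**  Let `s` be a
bilinear alternating form, `t` a `1`-form, `X` a vector and `ℓ` the functional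
`ℓ(w) = -2c · s(X, w)` (in the application `ℓ = dχ = c d(r²)`, `c = φ'(r²)`,
`s(X, ·) = -½ d(r²)`).  Then for all `v₂, v₃, v₄`,
`(ℓ ∧ (t ∧ s))(X, v₂, v₃, v₄) = c · t(X) · (s ∧ s)(X, v₂, v₃, v₄)` (the `ℓ ∧` in the
alternatization convention `wedgeOne`, the inner products in the tree's shuffle convention).
[cite: Mclean2012, Lemma 5.17 (proof)] -/
theorem wedgeOne_wedge_apply_frame (ℓ : E →L[ℝ] ℝ) (t : E [⋀^Fin 1]→L[ℝ] ℝ)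
    (s : E [⋀^Fin 2]→L[ℝ] ℝ) (X v₂ v₃ v₄ : E) (c : ℝ)
    (hℓ : ∀ w : E, ℓ w = -2 * c * s ![X, w]) :
    wedgeOne ℓ (t.wedge s) ![X, v₂, v₃, v₄] = c * t ![X] * (s.wedge s) ![X, v₂, v₃, v₄] := by
  have hXX : s ![X, X] = 0 :=
    s.map_eq_zero_of_eq ![X, X] (i := 0) (j := 1) rfl (by decide)
  rw [wedgeOne_apply, Fin.sum_univ_four]
  have hv0 : (![X, v₂, v₃, v₄] : Fin 4 → E) 0 = X := rfl
  have hv1 : (![X, v₂, v₃, v₄] : Fin 4 → E) 1 = v₂ := rfl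
  have hv2 : (![X, v₂, v₃, v₄] : Fin 4 → E) 2 = v₃ := rfl
  have hv3 : (![X, v₂, v₃, v₄] : Fin 4 → E) 3 = v₄ := rfl
  have h3 : ((3 : Fin (2 + 1 + 1)) : ℕ) = 3 := rfl
  simp only [hv0, hv1, hv2, hv3, removeNth_zero_four', removeNth_one_four', removeNth_two_four',
    removeNth_three_four', ContinuousAlternatingMap.wedge_apply_one_two,
    ContinuousAlternatingMap.wedge_self_apply_two, hℓ, hXX, Fin.val_zero, Fin.val_one,
    Fin.val_two, h3, pow_zero, pow_one, one_smul, zsmul_eq_mul, Int.cast_pow, Int.cast_neg,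
    Int.cast_one]
  ring

/-- **A top-degree form vanishing on every frame through a non-zero vector vanishes.**  On a
space of dimension `n + 1`, if `X ≠ 0` and `D(X, w₁, …, wₙ) = 0` for all `w`, then `D = 0`:
write `X = ∑ xᵢ bᵢ` in a basis with `x_j ≠ 0`, evaluate on `b` with `b_j` removed (only the
`j`-th term survives, by alternation), and conclude `D(b) = 0`, hence `D = 0`
(`Module.Basis.ext_alternating`).  Used to promote the frame identity
`wedgeOne_wedge_apply_frame` to an identity of `4`-forms. [folklore] -/
theorem eq_zero_of_forall_apply_cons_eq_zero [FiniteDimensional ℝ E] {n : ℕ}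
    (hn : Module.finrank ℝ E = n + 1) (D : E [⋀^Fin (n + 1)]→L[ℝ] ℝ) {X : E} (hX : X ≠ 0)
    (h : ∀ w : Fin n → E, D (Fin.cons X w) = 0) : D = 0 := by
  classical
  set b := Module.finBasisOfFinrankEq ℝ E hn with hb
  -- a non-zero coordinate of `X`
  obtain ⟨j, hj⟩ : ∃ j, b.repr X j ≠ 0 := by
    by_contra hcon
    apply hX
    have : b.repr X = 0 := Finsupp.ext fun i ↦ not_not.1 fun hi ↦ hcon ⟨i, hi⟩
    simpa using this
  -- evaluate on `b` with `b_j` removed: only the `j`-th term survives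
  set w : Fin n → E := fun m ↦ b (j.succAbove m) with hw
  have hlin : D (Fin.cons X w) = ∑ i, b.repr X i * D (Fin.cons (b i) w) := by
    have hc : ∀ y : E, D (Fin.cons y w) = D.curryLeft y w := fun y ↦ rfl
    conv_lhs => rw [← b.sum_repr X]
    rw [hc, map_sum, ContinuousAlternatingMap.sum_apply]
    refine Finset.sum_congr rfl fun i _ ↦ ?_
    rw [map_smul, ContinuousAlternatingMap.smul_apply, smul_eq_mul, hc]
  have hvan : ∀ i, i ≠ j → D (Fin.cons (b i) w) = 0 := by
    intro i hij
    obtain ⟨m, hm⟩ := Fin.exists_succAbove_eq hij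
    refine D.map_eq_zero_of_eq _ (i := 0) (j := m.succ) ?_ (Fin.succ_ne_zero m).symm
    simp [hw, hm]
  have hj0 : D (Fin.cons (b j) w) = 0 := by
    have h0 : ∑ i, b.repr X i * D (Fin.cons (b i) w) = 0 := by rw [← hlin]; exact h w
    rw [Finset.sum_eq_single j (fun i _ hij ↦ by rw [hvan i hij, mul_zero])
      (fun hj' ↦ absurd (Finset.mem_univ j) hj')] at h0
    exact (mul_eq_zero.1 h0).resolve_left hj
  -- hence `D(b) = 0`
  have hperm : (Fin.cons (b j) w : Fin (n + 1) → E) = b ∘ j.cycleRange.symm := by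
    funext m
    refine Fin.cases ?_ (fun i ↦ ?_) m
    · simp [Fin.cycleRange_symm_zero]
    · simp [hw, Fin.cycleRange_symm_succ]
  have hDb : D b = 0 := by
    have h1 : D (b ∘ j.cycleRange.symm) = (Equiv.Perm.sign j.cycleRange.symm : ℤ) • D b :=
      D.toAlternatingMap.map_perm b j.cycleRange.symm
    rw [← hperm, hj0] at h1
    rcases Int.units_eq_one_or (Equiv.Perm.sign j.cycleRange.symm) with hs | hs
    · rw [hs, Units.val_one, one_smul] at h1
      exact h1.symm
    · rw [hs, Units.val_neg, Units.val_one, neg_smul, one_smul] at h1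
      exact neg_eq_zero.1 h1.symm
  -- and `D = 0`
  have hA : D.toAlternatingMap = 0 := by
    refine Module.Basis.ext_alternating b fun v hv ↦ ?_
    rw [AlternatingMap.zero_apply]
    set σ : Equiv.Perm (Fin (n + 1)) := Equiv.ofBijective v (Finite.injective_iff_bijective.1 hv)
    have hvσ : (fun i ↦ b (v i)) = b ∘ σ := rfl
    rw [hvσ]
    have h2 : D (b ∘ σ) = (Equiv.Perm.sign σ : ℤ) • D b := D.toAlternatingMap.map_perm b σ
    change D (b ∘ σ) = 0
    rw [h2, hDb, smul_zero]
  ext v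
  have := congrArg (fun f : E [⋀^Fin (n + 1)]→ₗ[ℝ] ℝ ↦ f v) hA
  simpa using this

/-- **McLean's pointwise identity as an identity of `4`-forms.**  On a `4`-dimensional space,
with `X ≠ 0`, `ℓ(w) = -2c · s(X, w)`: `ℓ ∧ (t ∧ s) = (c · t(X)) • (s ∧ s)`.
[cite: Mclean2012, Lemma 5.17 (proof)] -/
theorem wedgeOne_wedge_eq_smul_wedge_self [FiniteDimensional ℝ E] (h4 : Module.finrank ℝ E = 4)
    (ℓ : E →L[ℝ] ℝ) (t : E [⋀^Fin 1]→L[ℝ] ℝ) (s : E [⋀^Fin 2]→L[ℝ] ℝ) {X : E} (hX : X ≠ 0)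
    (c : ℝ) (hℓ : ∀ w : E, ℓ w = -2 * c * s ![X, w]) :
    wedgeOne ℓ (t.wedge s) = (c * t ![X]) • (s.wedge s) := by
  rw [← sub_eq_zero]
  refine eq_zero_of_forall_apply_cons_eq_zero (n := 3) h4 _ hX fun w ↦ ?_
  have hw : (Fin.cons X w : Fin 4 → E) = ![X, w 0, w 1, w 2] := by
    funext i; fin_cases i <;> rfl
  rw [hw, ContinuousAlternatingMap.sub_apply, ContinuousAlternatingMap.smul_apply,
    wedgeOne_wedge_apply_frame ℓ t s X (w 0) (w 1) (w 2) c hℓ, smul_eq_mul, sub_self]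

end Literature.Geometry.Symplectic
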